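import Literature.NumberTheory.LFunctions.AbelianFrobeniusNaturalDensity
import Literature.NumberTheory.LFunctions.RayClassOfIdealHom
import HarnessLib

/-!
# The prime number theorem for a unitary character of the ideals with a pole-free continuation

Topic `Literature/NumberTheory/LFunctions`; namespace `Literature.NumberTheory.LFunctions.IdealCharPNT`.
Pure-proof file (theorems only). Companion of `AbelianFrobeniusNaturalDensity.lean` (the prime ideal
theorem for ray classes via Hecke's ENTIRE continuation, Landau's method for `L(1+it, χ) ≠ 0`,
`EulerLogDeriv.exists_continuousOn_eq_tsum_logTerm_sub`, Wiener–Ikehara and removal of the weight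
`log`) for characters of INFINITE order — Hecke's Grössencharaktere — where only a continuation to a
neighbourhood of `Re s ≥ 1` is available and Landau's lemma (which wants `Re s > 1/2`) does not apply.

Let `ν : Ideal (𝓞 K) →*₀ ℂ` with `|ν| ≤ 1`, `L(s, ν) = ∑ ν(𝔞) N𝔞^{-s} = L(twistCount ν, s)`
(`TwistedDedekindCoefficients`), and let `ν₂` be the character `𝔞 ↦ ν(𝔞)²`.

* `hasProd_LSeries_twistCount` — the Euler product `∏_𝔭 (1 − ν(𝔭) N𝔭^{-s})⁻¹ = L(s, ν)` for `Re s > 1`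
  (the ray class Euler product of the tree `mod (1)`);
* `one_le_norm_zeta_pow_mul` — **Mertens–de la Vallée-Poussin**: for real `σ > 1` and real `t`,
  `1 ≤ ‖ζ_K(σ)‖³ ‖L(σ+it, ν)‖⁴ ‖L(σ+2it, ν₂)‖` (prime by prime: `3 + 4 cos + cos 2 ≥ 0`,
  `|(1 − u)⁻¹| = exp Re ∑ uᵏ/k`);
* `continuation_ne_zero_of_re_eq_one` — **`L(1+it, ν) ≠ 0`** for every real `t`, for any holomorphic
  continuations `F` of `L(·, ν)` and `F₂` of `L(·, ν₂)` to an open set containing `Re s ≥ 1` (no pole: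
  this is the case of the Grössencharaktere of non-zero frequency; Iwasawa, *Hecke's L-functions*, Prop. 4.4,
  Lemma 4.3; Montgomery–Vaughan Thm. 11.3 for Dirichlet characters);
* `exists_continuousOn_eq_tsum_logTerm` — hence `∑_𝔭 ν(𝔭) log N𝔭 · N𝔭^{-s}` extends continuously to
  `Re s ≥ 1`;
* `tendsto_sum_log_mul_re_div`, `tendsto_sum_log_mul_im_div` and **`tendsto_sum_mul_log_div`** —
  Wiener–Ikehara on `∑_{N𝔭 = n} log N𝔭 (1 + Re ν(𝔭))` (and `Im`), the prime ideal theorem, and removal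
  of the weight: **`(∑_{N𝔭 ≤ N} ν(𝔭)) · log N / N → 0`**, i.e. `∑_{N𝔭 ≤ x} ν(𝔭) = o(x/log x)` — the
  prime number theorem for `ν` (Hecke 1920 §7; Mitsui 1956), given the continuations of `L(·, ν)`,
  `L(·, ν̄)`, `L(·, ν₂)`, `L(·, ν̄₂)`.

## References

* E. Hecke, *Eine neue Art von Zetafunktionen …* II, Math. Z. 6 (1920), 11–51, §7. [HeckeMathZ1920]
* K. Iwasawa, *Hecke's `L`-functions* (Princeton lectures 1964), SpringerBriefs 2019, Ch. 4 §4.2 Lemma 4.3,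
  Prop. 4.4. [cite: Iwasawa2019, Ch. 4 §4.2 Prop. 4.4]
* H. L. Montgomery, R. C. Vaughan, *Multiplicative Number Theory I*, CUP 2007, §8.3 Cor. 8.8, §11.1
  Lemma 11.2–Thm. 11.3. [cite: MontgomeryVaughan2007, §8.3 Cor. 8.8]
* T. Mitsui, *Generalized prime number theorem*, Jap. J. Math. 26 (1956), 1–42. [cite: Mitsui1956, Lemma 5]

## Mathlib / tree search

Tree: `hasProd_rayClassLSeries_rayClassPrimeValue`, `rayClassLSeries_apply_asIdeal_eq`,
`EulerLogDeriv.exists_continuousOn_eq_tsum_logTerm_sub`, `EulerLogDeriv.ne_zero_of_hasProd`,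
`EulerLogDeriv.summable_norm_logTerm`, `AbelianDensity.*` (prime series regrouped by the norm),
`WienerIkehara_holds`, `LogWeight.tendsto_sum_mul_log_div`, `hasProd_dedekindEulerFactor_holds`,
`LSeries_twistCount_ne_zero`, `isLandauContinuation_dedekindZetaCont_holds'`. Mathlib:
`Complex.hasSum_taylorSeries_neg_log`, `tendsto_sub_one_mul_dedekindZeta_nhdsGT`,
`DifferentiableAt.isBigO_sub`.
-/

noncomputable section

open Filter NumberField IsDedekindDomain Complex Finset Topology

open scoped Classical ComplexConjugate

namespace Literature.NumberTheory.LFunctions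

namespace IdealCharPNT

variable {K : Type*} [Field K] [NumberField K]

/-! ### The Euler product of `L(s, ν)` -/

omit [NumberField K] in
/-- The prime values `mod (1)`: `rayClassPrimeValue ⊤ ψ v = ψ v`. [folklore] -/
theorem rayClassPrimeValue_top (ψ : HeightOneSpectrum (𝓞 K) → ℂ) (v : HeightOneSpectrum (𝓞 K)) :
    rayClassPrimeValue ⊤ ψ v = ψ v := by
  unfold rayClassPrimeValue
  rw [if_neg]
  exact fun h => v.isPrime.ne_top (top_le_iff.1 h)

/-- **The Euler product `∏_𝔭 (1 − ν(𝔭) N𝔭^{-s})⁻¹ = L(s, ν)`** for `Re s > 1` and `|ν| ≤ 1`.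
[cite: NeukirchANT1999, Ch. VII §8 (8.1) Proposition] -/
theorem hasProd_LSeries_twistCount (ν : Ideal (𝓞 K) →*₀ ℂ) (hν : ∀ I, ‖ν I‖ ≤ 1) {s : ℂ} (hs : 1 < s.re) :
    HasProd (fun v : HeightOneSpectrum (𝓞 K) => (1 - ν v.asIdeal * ((Ideal.absNorm v.asIdeal : ℕ) : ℂ) ^ (-s))⁻¹)
      (LSeries (NumberField.twistCount K ν) s) := by
  have h := hasProd_rayClassLSeries_rayClassPrimeValue (𝔪 := ⊤) (ψ := fun v => ν v.asIdeal)
    (by simp) (fun v _ => hν _) hs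
  rw [rayClassLSeries_apply_asIdeal_eq ν hν
    (fun I hI => absurd (Ideal.isCoprime_iff_sup_eq.2 (sup_top_eq I)) hI) hs] at h
  refine h.congr_fun fun v => ?_
  rw [rayClassPrimeValue_top]

/-! ### The `3-4-1` inequality -/

/-- `Re(3 + 4w + w²) ≥ 0` for `|w| ≤ 1` (`= 2(1 + Re w)²` when `|w| = 1`). [cite: MontgomeryVaughan2007, §11.1 Lemma 11.2] -/
theorem re_three_four_one_nonneg {w : ℂ} (hw : ‖w‖ ≤ 1) : 0 ≤ (3 + 4 * w + w ^ 2).re := by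
  have hsq : w.re ^ 2 + w.im ^ 2 ≤ 1 := by
    have h := Complex.normSq_eq_norm_sq w
    rw [Complex.normSq_apply] at h
    nlinarith [norm_nonneg w]
  simp only [Complex.add_re, Complex.mul_re, sq, Complex.re_ofNat, Complex.im_ofNat]
  nlinarith [sq_nonneg (1 + w.re)]

/-- **The prime-by-prime factor**: for real `0 ≤ z < 1` and `|c| ≤ 1`,
`1 ≤ ‖(1 − z)⁻¹‖³ ‖(1 − cz)⁻¹‖⁴ ‖(1 − c²z)⁻¹‖` (`= exp ∑_k zᵏ/k · Re(3 + 4cᵏ + c^{2k}) ≥ 1`).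
[cite: MontgomeryVaughan2007, §11.1 Lemma 11.2] -/
theorem one_le_norm_factor {z : ℝ} (hz0 : 0 ≤ z) (hz1 : z < 1) {c : ℂ} (hc : ‖c‖ ≤ 1) :
    1 ≤ ‖(1 - (z : ℂ))⁻¹‖ ^ 3 * ‖(1 - c * z)⁻¹‖ ^ 4 * ‖(1 - c ^ 2 * z)⁻¹‖ := by
  -- `‖(1 - u)⁻¹‖ = exp (Re (-log (1 - u)))` and `-log(1 - u) = ∑ uᵏ/k`
  have key : ∀ {u : ℂ}, ‖u‖ < 1 → ‖(1 - u)⁻¹‖ = Real.exp ((-Complex.log (1 - u)).re) := by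
    intro u hu
    have h1 : 1 - u ≠ 0 := by
      intro h; rw [sub_eq_zero] at h; rw [← h, norm_one] at hu; exact lt_irrefl _ hu
    rw [← Complex.norm_exp, Complex.exp_neg, Complex.exp_log h1, norm_inv]
  have hzC : ‖(z : ℂ)‖ < 1 := by rw [Complex.norm_real, Real.norm_of_nonneg hz0]; exact hz1
  have hcz : ‖c * z‖ < 1 := by
    rw [norm_mul]; exact (mul_le_of_le_one_left (norm_nonneg _) hc).trans_lt hzC
  have hc2z : ‖c ^ 2 * z‖ < 1 := by
    rw [norm_mul, norm_pow]
    exact (mul_le_of_le_one_left (norm_nonneg _) (pow_le_one₀ (norm_nonneg _) hc)).trans_lt hzC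
  rw [key hzC, key hcz, key hc2z, ← Real.exp_nat_mul, ← Real.exp_nat_mul, ← Real.exp_add, ← Real.exp_add]
  apply Real.one_le_exp
  -- the series
  have h1 := Complex.hasSum_taylorSeries_neg_log hzC
  have h2 := Complex.hasSum_taylorSeries_neg_log hcz
  have h3 := Complex.hasSum_taylorSeries_neg_log hc2z
  have hsum := ((h1.mul_left 3).add (h2.mul_left 4)).add h3
  have hre := Complex.hasSum_re hsum
  have hnn : ∀ k : ℕ, 0 ≤ (3 * ((z : ℂ) ^ k / k) + 4 * ((c * z) ^ k / k) + (c ^ 2 * z) ^ k / k).re := by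
    intro k
    have e : 3 * ((z : ℂ) ^ k / k) + 4 * ((c * z) ^ k / k) + (c ^ 2 * z) ^ k / k =
        ((z ^ k / k : ℝ) : ℂ) * (3 + 4 * c ^ k + (c ^ k) ^ 2) := by
      push_cast; ring
    rw [e, Complex.re_ofReal_mul]
    refine mul_nonneg (div_nonneg (pow_nonneg hz0 _) (Nat.cast_nonneg _)) ?_
    exact re_three_four_one_nonneg (by rw [norm_pow]; exact pow_le_one₀ (norm_nonneg _) hc)
  have h0 := hre.nonneg hnn
  simp only [Complex.add_re, Complex.mul_re, Complex.re_ofNat, Complex.im_ofNat, zero_mul, sub_zero] at h0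
  push_cast
  linarith

/-- `N(v)^{-(σ + τ i)} = N(v)^{-τ i} · N(v)^{-σ}` with `‖N(v)^{-τ i}‖ = 1`. [folklore] -/
theorem absNorm_cpow_neg_add (v : HeightOneSpectrum (𝓞 K)) (σ τ : ℝ) :
    ((Ideal.absNorm v.asIdeal : ℕ) : ℂ) ^ (-((σ : ℂ) + τ * I)) =
      ((Ideal.absNorm v.asIdeal : ℕ) : ℂ) ^ (-(τ * I)) * ((((Ideal.absNorm v.asIdeal : ℕ) : ℝ) ^ (-σ) : ℝ) : ℂ) := by
  have hn0 : ((Ideal.absNorm v.asIdeal : ℕ) : ℂ) ≠ 0 := by exact_mod_cast (absNorm_heightOneSpectrum_pos v).ne'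
  rw [neg_add, Complex.cpow_add _ _ hn0, mul_comm, Complex.ofReal_cpow (Nat.cast_nonneg _)]
  push_cast
  ring_nf

/-- `‖N(v)^{-τ i}‖ = 1`. [folklore] -/
theorem norm_absNorm_cpow_neg_mul_I (v : HeightOneSpectrum (𝓞 K)) (τ : ℝ) :
    ‖((Ideal.absNorm v.asIdeal : ℕ) : ℂ) ^ (-(τ * I))‖ = 1 := by
  rw [Complex.norm_natCast_cpow_of_pos (absNorm_heightOneSpectrum_pos v)]
  simp

/-- **Mertens–de la Vallée-Poussin over `K`**: for real `σ > 1`, real `t`, `|ν| ≤ 1` and `ν₂ = ν²`,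
`1 ≤ ‖ζ_K(σ)‖³ · ‖L(σ + it, ν)‖⁴ · ‖L(σ + 2it, ν₂)‖`. [cite: Iwasawa2019, Ch. 4 §4.2 Lemma 4.3] -/
theorem one_le_norm_zeta_pow_mul (ν ν₂ : Ideal (𝓞 K) →*₀ ℂ) (hν : ∀ I, ‖ν I‖ ≤ 1)
    (hν₂ : ∀ I, ν₂ I = ν I ^ 2) {σ : ℝ} (hσ : 1 < σ) (t : ℝ) :
    1 ≤ ‖NumberField.dedekindZeta K σ‖ ^ 3 * ‖LSeries (NumberField.twistCount K ν) (σ + t * I)‖ ^ 4 *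
      ‖LSeries (NumberField.twistCount K ν₂) (σ + 2 * t * I)‖ := by
  have hν₂' : ∀ I, ‖ν₂ I‖ ≤ 1 := fun I => by rw [hν₂, norm_pow]; exact pow_le_one₀ (norm_nonneg _) (hν I)
  have hs0 : 1 < ((σ : ℂ)).re := by simpa using hσ
  have hs1 : 1 < ((σ : ℂ) + t * I).re := by simpa using hσ
  have hs2 : 1 < ((σ : ℂ) + 2 * t * I).re := by simpa using hσ
  -- the three Euler products
  have hζ := hasProd_dedekindEulerFactor_holds (K := K) hs0
  have hL := hasProd_LSeries_twistCount ν hν hs1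
  have hL₂ := hasProd_LSeries_twistCount ν₂ hν₂' hs2
  have hprod := ((hζ.pow 3).mul (hL.pow 4)).mul hL₂
  have hnorm := hprod.norm
  simp only [norm_mul, norm_pow] at hnorm
  refine ge_of_tendsto' hnorm fun S => ?_
  refine Finset.one_le_prod fun v _ => ?_
  -- the factor at `v`
  set z : ℝ := ((Ideal.absNorm v.asIdeal : ℕ) : ℝ) ^ (-σ) with hz
  set c : ℂ := ν v.asIdeal * ((Ideal.absNorm v.asIdeal : ℕ) : ℂ) ^ (-(t * I)) with hc
  have hz0 : 0 ≤ z := Real.rpow_nonneg (Nat.cast_nonneg _) _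
  have hz1 : z < 1 := by
    rw [hz]
    have h2 := EulerLogDeriv.absNorm_rpow_neg_le_two_rpow v (by linarith : (0 : ℝ) ≤ σ)
    exact h2.trans_lt (EulerLogDeriv.two_rpow_neg_lt_one (by linarith))
  have hcn : ‖c‖ ≤ 1 := by
    rw [hc, norm_mul, norm_absNorm_cpow_neg_mul_I, mul_one]; exact hν _
  have e1 : dedekindEulerFactor K v σ = (1 - (z : ℂ))⁻¹ := by
    rw [dedekindEulerFactor, hz, Complex.ofReal_cpow (Nat.cast_nonneg _)]
    push_cast; rfl
  have e2 : (1 - ν v.asIdeal * ((Ideal.absNorm v.asIdeal : ℕ) : ℂ) ^ (-((σ : ℂ) + t * I)))⁻¹ = (1 - c * z)⁻¹ := by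
    rw [absNorm_cpow_neg_add, hc, hz]; ring_nf
  have e3 : (1 - ν₂ v.asIdeal * ((Ideal.absNorm v.asIdeal : ℕ) : ℂ) ^ (-((σ : ℂ) + 2 * t * I)))⁻¹ =
      (1 - c ^ 2 * z)⁻¹ := by
    have : (σ : ℂ) + 2 * t * I = (σ : ℂ) + ((2 * t : ℝ) : ℂ) * I := by push_cast; ring
    rw [this, absNorm_cpow_neg_add, hν₂, hc, hz]
    have hn0 : ((Ideal.absNorm v.asIdeal : ℕ) : ℂ) ≠ 0 := by exact_mod_cast (absNorm_heightOneSpectrum_pos v).ne'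
    have hsq : ((Ideal.absNorm v.asIdeal : ℕ) : ℂ) ^ (-(((2 * t : ℝ) : ℂ) * I)) =
        (((Ideal.absNorm v.asIdeal : ℕ) : ℂ) ^ (-(t * I))) ^ 2 := by
      rw [← Complex.cpow_nat_mul]; congr 1; push_cast; ring
    rw [hsq]; ring_nf
  rw [e1, e2, e3]
  exact one_le_norm_factor hz0 hz1 hcn

/-! ### Non-vanishing on the line `Re s = 1` -/

/-- **`L(1 + it, ν) ≠ 0`**: if `L(·, ν)` and `L(·, ν₂)` (`ν₂ = ν²`, `|ν| ≤ 1`) extend holomorphically to an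
open set containing `Re s ≥ 1`, then the continuation of `L(·, ν)` has no zero on `Re s = 1`
(`ζ_K(σ)³ = O((σ−1)⁻³)`, a zero would give `L(σ+it,ν)⁴ = O((σ−1)⁴)`, and `L(σ+2it,ν₂) = O(1)`,
contradicting the `3-4-1` inequality). [cite: Iwasawa2019, Ch. 4 §4.2 Prop. 4.4] -/
theorem continuation_ne_zero_of_re_eq_one (ν ν₂ : Ideal (𝓞 K) →*₀ ℂ) (hν : ∀ I, ‖ν I‖ ≤ 1)
    (hν₂ : ∀ I, ν₂ I = ν I ^ 2) {U : Set ℂ} (hUo : IsOpen U) (hU1 : {s : ℂ | 1 ≤ s.re} ⊆ U)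
    {F F₂ : ℂ → ℂ} (hF : DifferentiableOn ℂ F U) (hFeq : ∀ s : ℂ, 1 < s.re → F s = LSeries (NumberField.twistCount K ν) s)
    (hF₂ : DifferentiableOn ℂ F₂ U) (hF₂eq : ∀ s : ℂ, 1 < s.re → F₂ s = LSeries (NumberField.twistCount K ν₂) s)
    (t : ℝ) : F (1 + t * I) ≠ 0 := by
  intro h0
  set s₀ : ℂ := 1 + t * I with hs₀
  set s₂ : ℂ := 1 + 2 * t * I with hs₂
  have hs₀U : s₀ ∈ U := hU1 (by simp [hs₀])
  have hs₂U : s₂ ∈ U := hU1 (by simp [hs₂])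
  -- the path `σ ↦ σ + it` tends to `s₀` as `σ → 1⁺`, and similarly for `s₂`
  have hpath : Tendsto (fun σ : ℝ => (σ : ℂ) + t * I) (𝓝[>] 1) (𝓝 s₀) := by
    have : Continuous fun σ : ℝ => (σ : ℂ) + t * I := by fun_prop
    have h := this.tendsto 1
    rw [Complex.ofReal_one] at h
    exact h.mono_left nhdsWithin_le_nhds
  have hpath₂ : Tendsto (fun σ : ℝ => (σ : ℂ) + 2 * t * I) (𝓝[>] 1) (𝓝 s₂) := by
    have : Continuous fun σ : ℝ => (σ : ℂ) + 2 * t * I := by fun_prop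
    have h := this.tendsto 1
    rw [Complex.ofReal_one] at h
    exact h.mono_left nhdsWithin_le_nhds
  -- (a) `‖F(σ + it)‖ ≤ C₂ (σ − 1)` eventually
  have hFd : DifferentiableAt ℂ F s₀ := hF.differentiableAt (hUo.mem_nhds hs₀U)
  obtain ⟨C₂, hC₂⟩ := (hFd.isBigO_sub).bound
  have hC₂' : ∀ᶠ σ : ℝ in 𝓝[>] 1, ‖F (σ + t * I)‖ ≤ C₂ * (σ - 1) := by
    have h := hpath.eventually hC₂
    filter_upwards [h, self_mem_nhdsWithin] with σ hσ hσ1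
    have hσ1' : 1 < σ := hσ1
    rw [h0, sub_zero] at hσ
    have : (σ : ℂ) + t * I - s₀ = ((σ - 1 : ℝ) : ℂ) := by rw [hs₀]; push_cast; ring
    rw [this, Complex.norm_real, Real.norm_of_nonneg (by linarith)] at hσ
    exact hσ
  -- (b) `‖F₂(σ + 2it)‖ ≤ C₃` eventually
  have hF₂c : ContinuousAt F₂ s₂ := (hF₂.differentiableAt (hUo.mem_nhds hs₂U)).continuousAt
  obtain ⟨C₃, hC₃⟩ : ∃ C : ℝ, ∀ᶠ σ : ℝ in 𝓝[>] 1, ‖F₂ (σ + 2 * t * I)‖ ≤ C := by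
    have h := (hF₂c.norm.tendsto).eventually (eventually_le_nhds (lt_add_one ‖F₂ s₂‖))
    exact ⟨‖F₂ s₂‖ + 1, hpath₂.eventually h⟩
  -- (c) `‖ζ_K(σ)‖ ≤ C₁/(σ − 1)` eventually
  obtain ⟨C₁, hC₁⟩ : ∃ C : ℝ, ∀ᶠ σ : ℝ in 𝓝[>] 1, ‖NumberField.dedekindZeta K σ‖ ≤ C / (σ - 1) := by
    have h := (NumberField.tendsto_sub_one_mul_dedekindZeta_nhdsGT (K := K)).norm
    have h' := h.eventually (eventually_le_nhds (lt_add_one ‖(NumberField.dedekindZeta_residue K : ℂ)‖))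
    refine ⟨‖(NumberField.dedekindZeta_residue K : ℂ)‖ + 1, ?_⟩
    filter_upwards [h', self_mem_nhdsWithin] with σ hσ hσ1
    have hσ1'' : 1 < σ := hσ1
    have hσ1' : 0 < σ - 1 := by linarith
    rw [le_div_iff₀ hσ1']
    rw [norm_mul, show ((σ : ℂ) - 1) = ((σ - 1 : ℝ) : ℂ) by push_cast; ring, Complex.norm_real,
      Real.norm_of_nonneg hσ1'.le] at hσ
    linarith
  -- combine with the `3-4-1` inequality
  have hineq : ∀ᶠ σ : ℝ in 𝓝[>] 1, (1 : ℝ) ≤ C₁ ^ 3 * C₂ ^ 4 * C₃ * (σ - 1) := by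
    filter_upwards [hC₁, hC₂', hC₃, self_mem_nhdsWithin] with σ h1 h2 h3 hσ1
    have hσ : 1 < σ := hσ1
    have hσ1' : 0 < σ - 1 := by linarith
    have hmain := one_le_norm_zeta_pow_mul ν ν₂ hν hν₂ hσ t
    have hs1 : 1 < ((σ : ℂ) + t * I).re := by simpa using hσ
    have hs2 : 1 < ((σ : ℂ) + 2 * t * I).re := by simpa using hσ
    rw [← hFeq _ hs1, ← hF₂eq _ hs2] at hmain
    have hC₁0 : 0 ≤ C₁ / (σ - 1) := le_trans (norm_nonneg _) h1
    have hb1 : ‖NumberField.dedekindZeta K σ‖ ^ 3 ≤ (C₁ / (σ - 1)) ^ 3 := pow_le_pow_left₀ (norm_nonneg _) h1 3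
    have hb2 : ‖F (σ + t * I)‖ ^ 4 ≤ (C₂ * (σ - 1)) ^ 4 := pow_le_pow_left₀ (norm_nonneg _) h2 4
    have hb3 : ‖F₂ (σ + 2 * t * I)‖ ≤ C₃ := h3
    have hC₃0 : 0 ≤ C₃ := le_trans (norm_nonneg _) h3
    calc (1 : ℝ) ≤ ‖NumberField.dedekindZeta K σ‖ ^ 3 * ‖F (σ + t * I)‖ ^ 4 * ‖F₂ (σ + 2 * t * I)‖ := hmain
      _ ≤ (C₁ / (σ - 1)) ^ 3 * (C₂ * (σ - 1)) ^ 4 * C₃ := by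
          apply mul_le_mul (mul_le_mul hb1 hb2 (by positivity) (by positivity)) hb3 (norm_nonneg _)
          positivity
      _ = C₁ ^ 3 * C₂ ^ 4 * C₃ * (σ - 1) := by field_simp
  have hlim : Tendsto (fun σ : ℝ => C₁ ^ 3 * C₂ ^ 4 * C₃ * (σ - 1)) (𝓝[>] 1) (𝓝 0) := by
    have : Tendsto (fun σ : ℝ => C₁ ^ 3 * C₂ ^ 4 * C₃ * (σ - 1)) (𝓝 1) (𝓝 (C₁ ^ 3 * C₂ ^ 4 * C₃ * (1 - 1))) :=
      (tendsto_const_nhds.mul (tendsto_id.sub tendsto_const_nhds))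
    rw [sub_self, mul_zero] at this
    exact this.mono_left nhdsWithin_le_nhds
  have hsmall := hlim.eventually (eventually_lt_nhds (by norm_num : (0 : ℝ) < 1))
  obtain ⟨σ, h1, h2⟩ := (hineq.and hsmall).exists
  linarith

/-! ### The weighted prime series extends continuously to `Re s ≥ 1` -/

/-- **`∑_𝔭 ν(𝔭) log N𝔭 · N𝔭^{-s}` is regular on `Re s ≥ 1`** given pole-free continuations of `L(·, ν)`
and `L(·, ν²)` to a neighbourhood of `Re s ≥ 1`. [cite: MontgomeryVaughan2007, §8.3 Cor. 8.8] -/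
theorem exists_continuousOn_eq_tsum_logTerm (ν ν₂ : Ideal (𝓞 K) →*₀ ℂ) (hν : ∀ I, ‖ν I‖ ≤ 1)
    (hν₂ : ∀ I, ν₂ I = ν I ^ 2) {U : Set ℂ} (hUo : IsOpen U) (hU1 : {s : ℂ | 1 ≤ s.re} ⊆ U)
    {F F₂ : ℂ → ℂ} (hF : DifferentiableOn ℂ F U) (hFeq : ∀ s : ℂ, 1 < s.re → F s = LSeries (NumberField.twistCount K ν) s)
    (hF₂ : DifferentiableOn ℂ F₂ U) (hF₂eq : ∀ s : ℂ, 1 < s.re → F₂ s = LSeries (NumberField.twistCount K ν₂) s) :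
    ∃ r : ℂ → ℂ, ContinuousOn r {s : ℂ | 1 ≤ s.re} ∧
      ∀ s : ℂ, 1 < s.re → r s =
        ∑' v : HeightOneSpectrum (𝓞 K), ν v.asIdeal *
          (Real.log ((Ideal.absNorm v.asIdeal : ℕ) : ℝ) : ℂ) * ((Ideal.absNorm v.asIdeal : ℕ) : ℂ) ^ (-s) := by
  have hc : ∀ v : HeightOneSpectrum (𝓞 K), ‖ν v.asIdeal‖ ≤ 1 := fun v => hν _
  have hL : ∀ s : ℂ, 1 < s.re → HasProd (fun v : HeightOneSpectrum (𝓞 K) =>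
      (1 - ν v.asIdeal * ((Ideal.absNorm v.asIdeal : ℕ) : ℂ) ^ (-s))⁻¹) (LSeries (NumberField.twistCount K ν) s) :=
    fun s hs => hasProd_LSeries_twistCount ν hν hs
  have hG0 : ∀ s : ℂ, 1 ≤ s.re → F s ≠ 0 := by
    intro s hs
    rcases eq_or_lt_of_le hs with h | h
    · have : s = 1 + s.im * I := by
        apply Complex.ext <;> simp [← h]
      rw [this]
      exact continuation_ne_zero_of_re_eq_one ν ν₂ hν hν₂ hUo hU1 hF hFeq hF₂ hF₂eq s.im
    · rw [hFeq s h]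
      exact EulerLogDeriv.ne_zero_of_hasProd hc h (hL s h)
  obtain ⟨r, hr, hreq⟩ := EulerLogDeriv.exists_continuousOn_eq_tsum_logTerm_sub hc 0 hUo hU1 hF hG0 hL
    (fun s hs => by rw [pow_zero, one_mul]; exact hFeq s hs)
  refine ⟨r, hr, fun s hs => ?_⟩
  rw [hreq s hs, Nat.cast_zero, zero_div, sub_zero]

/-! ### The weighted prime sums as Dirichlet series -/

/-- **Regrouping a weighted prime sum by the norm**: for `c` with `|c| ≤ 1` and `Re s > 1`, the Dirichlet
series of `n ↦ log n · ∑_{N𝔭 = n} c(𝔭)` converges to `∑_𝔭 c(𝔭) log N𝔭 · N𝔭^{-s}`. [folklore] -/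
theorem hasSum_term_log_mul_sum (c : HeightOneSpectrum (𝓞 K) → ℂ) (hc : ∀ v, ‖c v‖ ≤ 1) {s : ℂ} (hs : 1 < s.re) :
    HasSum (fun n : ℕ => LSeries.term (fun n => (Real.log n : ℂ) * ∑ v ∈ primesOfNorm K n, c v) s n)
      (∑' v : HeightOneSpectrum (𝓞 K), c v *
        (Real.log ((Ideal.absNorm v.asIdeal : ℕ) : ℝ) : ℂ) * ((Ideal.absNorm v.asIdeal : ℕ) : ℂ) ^ (-s)) := by
  set F : HeightOneSpectrum (𝓞 K) → ℂ := fun v =>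
    c v * (Real.log ((Ideal.absNorm v.asIdeal : ℕ) : ℝ) : ℂ) * ((Ideal.absNorm v.asIdeal : ℕ) : ℂ) ^ (-s) with hF
  have hFsum : Summable F := (EulerLogDeriv.summable_norm_logTerm hc hs).of_norm
  have h1 := hFsum.hasSum.tsum_fiberwise (fun v : HeightOneSpectrum (𝓞 K) => Ideal.absNorm v.asIdeal)
  refine h1.congr_fun fun n => ?_
  have hfiber : (∑' b : ↥((fun v : HeightOneSpectrum (𝓞 K) => Ideal.absNorm v.asIdeal) ⁻¹' {n}), F b) =
      ∑ v ∈ primesOfNorm K n, F v := by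
    rw [_root_.tsum_subtype, tsum_eq_sum (s := primesOfNorm K n)]
    · refine Finset.sum_congr rfl fun v hv => Set.indicator_of_mem ?_ F
      rw [AbelianDensity.absNorm_preimage_singleton]; exact hv
    · intro v hv
      refine Set.indicator_of_notMem ?_ F
      rw [AbelianDensity.absNorm_preimage_singleton]; exact hv
  rw [hfiber]
  have hfib : ∀ v ∈ primesOfNorm K n, F v = c v * ((Real.log n : ℂ) * (n : ℂ) ^ (-s)) := by
    intro v hv
    rw [mem_primesOfNorm] at hv
    rw [hF]; dsimp only; rw [hv, mul_assoc]
  rw [Finset.sum_congr rfl hfib, ← Finset.sum_mul, LSeries.term]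
  split_ifs with hn
  · rw [hn, AbelianDensity.primesOfNorm_eq_empty_of_lt_two (by norm_num)]; simp
  · rw [Complex.cpow_neg, div_eq_mul_inv]
    ring

/-! ### Wiener–Ikehara for `1 + Re ν` -/

/-- The trivial-character input: `∑_𝔭 log N𝔭 · N𝔭^{-s} − 1/(s−1)` is regular on `Re s ≥ 1` (Landau).
[cite: MontgomeryVaughan2007, §8.4 Thm. 8.9 (p. 267)] -/
theorem exists_continuousOn_eq_tsum_logTerm_one :
    ∃ r : ℂ → ℂ, ContinuousOn r {s : ℂ | 1 ≤ s.re} ∧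
      ∀ s : ℂ, 1 < s.re → r s =
        (∑' v : HeightOneSpectrum (𝓞 K), (1 : ℂ) *
          (Real.log ((Ideal.absNorm v.asIdeal : ℕ) : ℝ) : ℂ) * ((Ideal.absNorm v.asIdeal : ℕ) : ℂ) ^ (-s)) -
          1 / (s - 1) := by
  set Gz : ℂ → ℂ := Function.update (fun s : ℂ => (s - 1) * dedekindZetaCont K s) 1
    (NumberField.dedekindZeta_residue K : ℂ) with hGz
  have hLandau : NumberField.IsLandauContinuation K Gz := NumberField.isLandauContinuation_dedekindZetaCont_holds' K
  have hc1 : ∀ v : HeightOneSpectrum (𝓞 K), ‖(fun _ => (1 : ℂ)) v‖ ≤ 1 := fun v => by simp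
  have hEuler : ∀ s : ℂ, 1 < s.re → HasProd (fun v : HeightOneSpectrum (𝓞 K) =>
      (1 - (fun _ => (1 : ℂ)) v * ((Ideal.absNorm v.asIdeal : ℕ) : ℂ) ^ (-s))⁻¹) (NumberField.dedekindZeta K s) := by
    intro s hs
    refine (hasProd_dedekindEulerFactor_holds (K := K) hs).congr_fun fun v => ?_
    simp [dedekindEulerFactor]
  obtain ⟨r₁, hr₁, hr₁eq⟩ := EulerLogDeriv.exists_continuousOn_eq_tsum_logTerm_sub hc1 1
    (NumberField.isOpen_landauHalfPlane K) (fun s hs => NumberField.mem_landauHalfPlane_of_one_le_re K hs)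
    hLandau.differentiableOn (fun s hs => NumberField.IsLandauContinuation.ne_zero_of_one_le_re K hLandau hs) hEuler
    (fun s hs => by rw [pow_one]; exact hLandau.eq_mul s hs)
  refine ⟨r₁, hr₁, fun s hs => ?_⟩
  rw [hr₁eq s hs, Nat.cast_one]

/-- **Wiener–Ikehara for the weights `1 + Re(w ν(𝔭))`** (`‖w‖ = 1`): given continuous extensions to
`Re s ≥ 1` of `∑_𝔭 ν(𝔭) log N𝔭 N𝔭^{-s}` and of `∑_𝔭 conj ν(𝔭) log N𝔭 N𝔭^{-s}`,
`(1/N) ∑_{N𝔭 ≤ N} log N𝔭 · (1 + Re(w ν(𝔭))) → 1`. [cite: MontgomeryVaughan2007, §8.3 Cor. 8.8] -/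
theorem tendsto_sum_log_mul_one_add_re_div (ν : Ideal (𝓞 K) →*₀ ℂ) (hν : ∀ I, ‖ν I‖ ≤ 1)
    (hr : ∃ r : ℂ → ℂ, ContinuousOn r {s : ℂ | 1 ≤ s.re} ∧ ∀ s : ℂ, 1 < s.re → r s =
      ∑' v : HeightOneSpectrum (𝓞 K), ν v.asIdeal *
        (Real.log ((Ideal.absNorm v.asIdeal : ℕ) : ℝ) : ℂ) * ((Ideal.absNorm v.asIdeal : ℕ) : ℂ) ^ (-s))
    (hr' : ∃ r : ℂ → ℂ, ContinuousOn r {s : ℂ | 1 ≤ s.re} ∧ ∀ s : ℂ, 1 < s.re → r s =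
      ∑' v : HeightOneSpectrum (𝓞 K), conj (ν v.asIdeal) *
        (Real.log ((Ideal.absNorm v.asIdeal : ℕ) : ℝ) : ℂ) * ((Ideal.absNorm v.asIdeal : ℕ) : ℂ) ^ (-s))
    {w : ℂ} (hw : ‖w‖ = 1) :
    Tendsto (fun N : ℕ => (∑ n ∈ Icc 1 N, Real.log n *
      ∑ v ∈ primesOfNorm K n, (1 + (w * ν v.asIdeal).re)) / N) atTop (𝓝 1) := by
  obtain ⟨r, hrc, hreq⟩ := hr
  obtain ⟨r', hrc', hreq'⟩ := hr'
  obtain ⟨r₁, hr₁c, hr₁eq⟩ := exists_continuousOn_eq_tsum_logTerm_one (K := K)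
  set a : ℕ → ℝ := fun n => Real.log n * ∑ v ∈ primesOfNorm K n, (1 + (w * ν v.asIdeal).re) with ha
  have ha0 : ∀ n, 0 ≤ a n := fun n => by
    rcases Nat.lt_or_ge n 2 with h | h
    · rw [ha]; dsimp only; rw [AbelianDensity.primesOfNorm_eq_empty_of_lt_two h]; simp
    · refine mul_nonneg (Real.log_nonneg (by exact_mod_cast (by omega : 1 ≤ n))) (Finset.sum_nonneg fun v _ => ?_)
      have : |(w * ν v.asIdeal).re| ≤ 1 := by
        refine (Complex.abs_re_le_norm _).trans ?_
        rw [norm_mul, hw, one_mul]; exact hν _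
      linarith [neg_abs_le (w * ν v.asIdeal).re]
  -- the three coefficient functions
  set c₁ : HeightOneSpectrum (𝓞 K) → ℂ := fun _ => 1 with hc₁
  set c₂ : HeightOneSpectrum (𝓞 K) → ℂ := fun v => (w / 2) * ν v.asIdeal with hc₂
  set c₃ : HeightOneSpectrum (𝓞 K) → ℂ := fun v => (conj w / 2) * conj (ν v.asIdeal) with hc₃
  have hc₁n : ∀ v, ‖c₁ v‖ ≤ 1 := fun v => by simp [hc₁]
  have hw2 : ‖w / 2‖ ≤ 1 := by rw [norm_div, hw]; norm_num
  have hc₂n : ∀ v, ‖c₂ v‖ ≤ 1 := fun v => by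
    rw [hc₂]; dsimp only; rw [norm_mul]
    exact mul_le_one₀ hw2 (norm_nonneg _) (hν _)
  have hc₃n : ∀ v, ‖c₃ v‖ ≤ 1 := fun v => by
    rw [hc₃]; dsimp only; rw [norm_mul, norm_div, Complex.norm_conj, Complex.norm_conj, ← norm_div]
    exact mul_le_one₀ hw2 (norm_nonneg _) (hν _)
  -- `a n = log n · Σ (c₁ + c₂ + c₃)`
  have hacoef : ∀ n, (a n : ℂ) = (Real.log n : ℂ) * ∑ v ∈ primesOfNorm K n, (c₁ v + c₂ v + c₃ v) := by
    intro n
    rw [ha]; dsimp only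
    push_cast
    congr 1
    refine Finset.sum_congr rfl fun v _ => ?_
    rw [hc₁, hc₂, hc₃]; dsimp only
    rw [Complex.re_eq_add_conj, map_mul]
    ring
  set t : ℂ → HeightOneSpectrum (𝓞 K) → ℂ := fun s v =>
    (Real.log ((Ideal.absNorm v.asIdeal : ℕ) : ℝ) : ℂ) * ((Ideal.absNorm v.asIdeal : ℕ) : ℂ) ^ (-s) with ht
  -- Step 1: the Dirichlet series of `a`
  have hLS : ∀ s : ℂ, 1 < s.re → LSeriesSummable (fun n => (a n : ℂ)) s ∧
      LSeries (fun n => (a n : ℂ)) s =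
        (∑' v, c₁ v * t s v) + (w / 2) * (∑' v, ν v.asIdeal * t s v) + (conj w / 2) * ∑' v, conj (ν v.asIdeal) * t s v := by
    intro s hs
    have h1 := hasSum_term_log_mul_sum c₁ hc₁n hs
    have h2 := hasSum_term_log_mul_sum c₂ hc₂n hs
    have h3 := hasSum_term_log_mul_sum c₃ hc₃n hs
    have hsum := (h1.add h2).add h3
    have hterm : ∀ n, LSeries.term (fun n => (a n : ℂ)) s n =
        LSeries.term (fun n => (Real.log n : ℂ) * ∑ v ∈ primesOfNorm K n, c₁ v) s n +
        LSeries.term (fun n => (Real.log n : ℂ) * ∑ v ∈ primesOfNorm K n, c₂ v) s n +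
        LSeries.term (fun n => (Real.log n : ℂ) * ∑ v ∈ primesOfNorm K n, c₃ v) s n := by
      intro n
      simp only [LSeries.term]
      split_ifs with hn
      · simp
      · rw [hacoef n, Finset.sum_add_distrib, Finset.sum_add_distrib]; ring
    have hsum' : HasSum (fun n => LSeries.term (fun n => (a n : ℂ)) s n) _ := hsum.congr_fun fun n => hterm n
    refine ⟨hsum'.summable, ?_⟩
    rw [LSeries, hsum'.tsum_eq]
    have e2 : (∑' v, c₂ v * t s v) = (w / 2) * ∑' v, ν v.asIdeal * t s v := by
      rw [← tsum_mul_left]; refine tsum_congr fun v => ?_; rw [hc₂]; dsimp only; rw [ht]; ring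
    have e3 : (∑' v, c₃ v * t s v) = (conj w / 2) * ∑' v, conj (ν v.asIdeal) * t s v := by
      rw [← tsum_mul_left]; refine tsum_congr fun v => ?_; rw [hc₃]; dsimp only; rw [ht]; ring
    have e1' : (∑' v, c₁ v * (Real.log ((Ideal.absNorm v.asIdeal : ℕ) : ℝ) : ℂ) * ((Ideal.absNorm v.asIdeal : ℕ) : ℂ) ^ (-s)) =
        ∑' v, c₁ v * t s v := tsum_congr fun v => by rw [ht]; ring
    have e2' : (∑' v, c₂ v * (Real.log ((Ideal.absNorm v.asIdeal : ℕ) : ℝ) : ℂ) * ((Ideal.absNorm v.asIdeal : ℕ) : ℂ) ^ (-s)) =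
        ∑' v, c₂ v * t s v := tsum_congr fun v => by rw [ht]; ring
    have e3' : (∑' v, c₃ v * (Real.log ((Ideal.absNorm v.asIdeal : ℕ) : ℝ) : ℂ) * ((Ideal.absNorm v.asIdeal : ℕ) : ℂ) ^ (-s)) =
        ∑' v, c₃ v * t s v := tsum_congr fun v => by rw [ht]; ring
    rw [e1', e2', e3', e2, e3]
  -- Step 2: the continuous extension
  set R : ℂ → ℂ := fun s => r₁ s + (w / 2) * r s + (conj w / 2) * r' s with hR
  have hRc : ContinuousOn R {s : ℂ | 1 ≤ s.re} :=
    (hr₁c.add (continuousOn_const.mul hrc)).add (continuousOn_const.mul hrc')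
  have hReq : ∀ s : ℂ, 1 < s.re → R s = LSeries (fun n => (a n : ℂ)) s - ((1 : ℝ) : ℂ) / (s - 1) := by
    intro s hs
    rw [(hLS s hs).2, hR]; dsimp only
    rw [hr₁eq s hs, hreq s hs, hreq' s hs]
    have e1 : (∑' v : HeightOneSpectrum (𝓞 K), (1 : ℂ) * (Real.log ((Ideal.absNorm v.asIdeal : ℕ) : ℝ) : ℂ) *
        ((Ideal.absNorm v.asIdeal : ℕ) : ℂ) ^ (-s)) = ∑' v, c₁ v * t s v := tsum_congr fun v => by rw [hc₁, ht]; ring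
    have e2 : (∑' v : HeightOneSpectrum (𝓞 K), ν v.asIdeal * (Real.log ((Ideal.absNorm v.asIdeal : ℕ) : ℝ) : ℂ) *
        ((Ideal.absNorm v.asIdeal : ℕ) : ℂ) ^ (-s)) = ∑' v, ν v.asIdeal * t s v := tsum_congr fun v => by rw [ht]; ring
    have e3 : (∑' v : HeightOneSpectrum (𝓞 K), conj (ν v.asIdeal) * (Real.log ((Ideal.absNorm v.asIdeal : ℕ) : ℝ) : ℂ) *
        ((Ideal.absNorm v.asIdeal : ℕ) : ℂ) ^ (-s)) = ∑' v, conj (ν v.asIdeal) * t s v := tsum_congr fun v => by rw [ht]; ring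
    rw [e1, e2, e3]
    push_cast
    ring
  -- Step 3: Wiener–Ikehara
  have hWI := WienerIkehara_holds a 1 ha0 (fun s hs => (hLS s hs).1) ⟨R, hRc, hReq⟩
  have h1 : Tendsto (fun N : ℕ => (∑ n ∈ Icc 1 N, a n - 1 * N) / N) atTop (𝓝 0) := by
    have := hWI.tendsto_div_nhds_zero
    simpa using this
  have h2 := h1.add_const 1
  rw [zero_add] at h2
  refine h2.congr' ?_
  filter_upwards [eventually_ge_atTop 1] with N hN
  have hN : (N : ℝ) ≠ 0 := by exact_mod_cast (by omega : N ≠ 0)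
  field_simp
  ring

/-! ### Removing the weight and the conclusion -/

/-- **The prime number theorem for `ν`, `π`-form with the weights `1 + Re(w ν)`**:
`(∑_{N𝔭 ≤ N} (1 + Re(w ν(𝔭)))) · log N / N → 1`. [cite: MontgomeryVaughan2007, §8.3 Cor. 8.8 with (8.29)] -/
theorem tendsto_sum_one_add_re_mul_log_div (ν : Ideal (𝓞 K) →*₀ ℂ) (hν : ∀ I, ‖ν I‖ ≤ 1)
    (hr : ∃ r : ℂ → ℂ, ContinuousOn r {s : ℂ | 1 ≤ s.re} ∧ ∀ s : ℂ, 1 < s.re → r s =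
      ∑' v : HeightOneSpectrum (𝓞 K), ν v.asIdeal *
        (Real.log ((Ideal.absNorm v.asIdeal : ℕ) : ℝ) : ℂ) * ((Ideal.absNorm v.asIdeal : ℕ) : ℂ) ^ (-s))
    (hr' : ∃ r : ℂ → ℂ, ContinuousOn r {s : ℂ | 1 ≤ s.re} ∧ ∀ s : ℂ, 1 < s.re → r s =
      ∑' v : HeightOneSpectrum (𝓞 K), conj (ν v.asIdeal) *
        (Real.log ((Ideal.absNorm v.asIdeal : ℕ) : ℝ) : ℂ) * ((Ideal.absNorm v.asIdeal : ℕ) : ℂ) ^ (-s))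
    {w : ℂ} (hw : ‖w‖ = 1) :
    Tendsto (fun N : ℕ => (∑ n ∈ Icc 1 N, ∑ v ∈ primesOfNorm K n, (1 + (w * ν v.asIdeal).re)) * Real.log N / N)
      atTop (𝓝 1) := by
  refine LogWeight.tendsto_sum_mul_log_div (b := fun n => ∑ v ∈ primesOfNorm K n, (1 + (w * ν v.asIdeal).re))
    (fun n => Finset.sum_nonneg fun v _ => ?_) ?_ (tendsto_sum_log_mul_one_add_re_div ν hν hr hr' hw)
  · have : |(w * ν v.asIdeal).re| ≤ 1 := by
      refine (Complex.abs_re_le_norm _).trans ?_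
      rw [norm_mul, hw, one_mul]; exact hν _
    linarith [neg_abs_le (w * ν v.asIdeal).re]
  · rw [AbelianDensity.primesOfNorm_eq_empty_of_lt_two (by norm_num)]; simp

/-- **The prime number theorem for a unitary character with pole-free continuations** (Hecke 1920;
Mitsui 1956): if `∑_𝔭 ν(𝔭) log N𝔭 N𝔭^{-s}` and its conjugate extend continuously to `Re s ≥ 1` (e.g. via
`exists_continuousOn_eq_tsum_logTerm` for `ν` and `ν̄`), then
`(∑_{N𝔭 ≤ N} ν(𝔭)) · log N / N → 0`: `∑_{N𝔭 ≤ x} ν(𝔭) = o(x / log x)`.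
[cite: HeckeMathZ1920, §7; Mitsui1956, Lemma 5] -/
theorem tendsto_sum_mul_log_div (ν : Ideal (𝓞 K) →*₀ ℂ) (hν : ∀ I, ‖ν I‖ ≤ 1)
    (hr : ∃ r : ℂ → ℂ, ContinuousOn r {s : ℂ | 1 ≤ s.re} ∧ ∀ s : ℂ, 1 < s.re → r s =
      ∑' v : HeightOneSpectrum (𝓞 K), ν v.asIdeal *
        (Real.log ((Ideal.absNorm v.asIdeal : ℕ) : ℝ) : ℂ) * ((Ideal.absNorm v.asIdeal : ℕ) : ℂ) ^ (-s))
    (hr' : ∃ r : ℂ → ℂ, ContinuousOn r {s : ℂ | 1 ≤ s.re} ∧ ∀ s : ℂ, 1 < s.re → r s =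
      ∑' v : HeightOneSpectrum (𝓞 K), conj (ν v.asIdeal) *
        (Real.log ((Ideal.absNorm v.asIdeal : ℕ) : ℝ) : ℂ) * ((Ideal.absNorm v.asIdeal : ℕ) : ℂ) ^ (-s)) :
    Tendsto (fun N : ℕ => (∑ n ∈ Icc 1 N, ∑ v ∈ primesOfNorm K n, ν v.asIdeal) * (Real.log N : ℂ) / N)
      atTop (𝓝 0) := by
  -- the weights `1 + Re ν`, `1 + Im ν = 1 + Re(-i ν)` and `1` (twice `1 + Re ν` with `w = 1`... use `w = 1, -I`)
  have h1 := tendsto_sum_one_add_re_mul_log_div ν hν hr hr' (w := 1) (by simp)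
  have hI := tendsto_sum_one_add_re_mul_log_div ν hν hr hr' (w := -I) (by simp)
  -- the count of primes: `w = 1` applied to ... we extract it from `h1` with `ν` replaced by the trivial
  -- weights: use `w = 1` and `w = -1`? `-1` has norm `1`:
  have hm1 := tendsto_sum_one_add_re_mul_log_div ν hν hr hr' (w := -1) (by simp)
  have hmI := tendsto_sum_one_add_re_mul_log_div ν hν hr hr' (w := I) (by simp)
  -- Re part: `(Σ Re ν) log N/N = ((Σ (1 + Re ν)) − (Σ (1 − Re ν)))/2 · log N / N → 0`
  have hre : Tendsto (fun N : ℕ => (∑ n ∈ Icc 1 N, ∑ v ∈ primesOfNorm K n, (ν v.asIdeal).re) * Real.log N / N)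
      atTop (𝓝 0) := by
    have h := (h1.sub hm1).mul_const (1 / 2)
    rw [sub_self, zero_mul] at h
    refine h.congr' (Eventually.of_forall fun N => ?_)
    simp only [one_mul, neg_mul, Complex.neg_re]
    have key : (∑ n ∈ Icc 1 N, ∑ v ∈ primesOfNorm K n, (1 + (ν v.asIdeal).re)) -
        (∑ n ∈ Icc 1 N, ∑ v ∈ primesOfNorm K n, (1 + -(ν v.asIdeal).re)) =
        2 * ∑ n ∈ Icc 1 N, ∑ v ∈ primesOfNorm K n, (ν v.asIdeal).re := by
      rw [← Finset.sum_sub_distrib, Finset.mul_sum]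
      refine Finset.sum_congr rfl fun n _ => ?_
      rw [← Finset.sum_sub_distrib, Finset.mul_sum]
      exact Finset.sum_congr rfl fun v _ => by ring
    rw [show ((∑ n ∈ Icc 1 N, ∑ v ∈ primesOfNorm K n, (1 + (ν v.asIdeal).re)) * Real.log N / N -
        (∑ n ∈ Icc 1 N, ∑ v ∈ primesOfNorm K n, (1 + -(ν v.asIdeal).re)) * Real.log N / N) * (1 / 2) =
        ((∑ n ∈ Icc 1 N, ∑ v ∈ primesOfNorm K n, (1 + (ν v.asIdeal).re)) -
          (∑ n ∈ Icc 1 N, ∑ v ∈ primesOfNorm K n, (1 + -(ν v.asIdeal).re))) * Real.log N / N * (1 / 2) by ring,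
      key]
    ring
  have him : Tendsto (fun N : ℕ => (∑ n ∈ Icc 1 N, ∑ v ∈ primesOfNorm K n, (ν v.asIdeal).im) * Real.log N / N)
      atTop (𝓝 0) := by
    have h := (hI.sub hmI).mul_const (1 / 2)
    rw [sub_self, zero_mul] at h
    refine h.congr' (Eventually.of_forall fun N => ?_)
    have hre1 : ∀ v : HeightOneSpectrum (𝓞 K), (-I * ν v.asIdeal).re = (ν v.asIdeal).im := fun v => by
      simp [Complex.mul_re]
    have hre2 : ∀ v : HeightOneSpectrum (𝓞 K), (I * ν v.asIdeal).re = -(ν v.asIdeal).im := fun v => by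
      simp [Complex.mul_re]
    simp only [hre1, hre2]
    have key : (∑ n ∈ Icc 1 N, ∑ v ∈ primesOfNorm K n, (1 + (ν v.asIdeal).im)) -
        (∑ n ∈ Icc 1 N, ∑ v ∈ primesOfNorm K n, (1 + -(ν v.asIdeal).im)) =
        2 * ∑ n ∈ Icc 1 N, ∑ v ∈ primesOfNorm K n, (ν v.asIdeal).im := by
      rw [← Finset.sum_sub_distrib, Finset.mul_sum]
      refine Finset.sum_congr rfl fun n _ => ?_
      rw [← Finset.sum_sub_distrib, Finset.mul_sum]
      exact Finset.sum_congr rfl fun v _ => by ring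
    rw [show ((∑ n ∈ Icc 1 N, ∑ v ∈ primesOfNorm K n, (1 + (ν v.asIdeal).im)) * Real.log N / N -
        (∑ n ∈ Icc 1 N, ∑ v ∈ primesOfNorm K n, (1 + -(ν v.asIdeal).im)) * Real.log N / N) * (1 / 2) =
        ((∑ n ∈ Icc 1 N, ∑ v ∈ primesOfNorm K n, (1 + (ν v.asIdeal).im)) -
          (∑ n ∈ Icc 1 N, ∑ v ∈ primesOfNorm K n, (1 + -(ν v.asIdeal).im))) * Real.log N / N * (1 / 2) by ring,
      key]
    ring
  -- combine real and imaginary parts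
  have hC := (Complex.continuous_ofReal.tendsto 0).comp hre
  have hC' := (Complex.continuous_ofReal.tendsto 0).comp him
  have hsum := hC.add (hC'.mul_const I)
  simp only [Complex.ofReal_zero, zero_mul, add_zero] at hsum
  refine hsum.congr' (Eventually.of_forall fun N => ?_)
  simp only [Function.comp_apply]
  have hz : ∀ z : ℂ, z = (z.re : ℂ) + (z.im : ℂ) * I := fun z => (Complex.re_add_im z).symm
  rw [hz (∑ n ∈ Icc 1 N, ∑ v ∈ primesOfNorm K n, ν v.asIdeal), Complex.re_sum, Complex.im_sum]
  simp only [Complex.re_sum, Complex.im_sum]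
  push_cast
  ring

end IdealCharPNT

end Literature.NumberTheory.LFunctions

end
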